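import Summits.QuantumFields.YangMills.Theorems.FemtoTransferGapGroundState
import Summits.QuantumFields.YangMills.Theorems.LuscherReductionRunningReductionKTPhysSpace
import HarnessLib

/-!
# Crux RED `RunningReduction` (stmt-QuantumFields-19978), line «KTR», stub `stub_dressedRitz` — the VACUUM DICTIONARY:
# Euclidean access to the exact ground state `Ω` (power iteration with Jentzsch's rate; Feynman–Kac with free temporal boundary)

Crux-ideate seat `ym-cruxidea-19978-1` (card `kato-temple-precision-transfer-r3`), GEN 6.  Workfile for
`Cruxes/RunningReduction/Lines/`; imports are tree-built Theorems only; sorry-free.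

WHY.  The typed cut under the registered stub `KT.stub_dressedRitz` is `KTGen.ExcitedPlateau` (tree
`Cruxes/RunningReduction/Lines/DressedRitzGEVP.lean` rev 3, §9): its vacuum generator is the EXACT physical ground state `Ω` of the
zero-flux transfer operator `K_β` and every remaining clause is a number attached to `Ω` — vacuum overlaps `⟨Ω, w_i⟩` (x3), and, through the
natural witnesses `w_i = O_iΩ/‖O_iΩ‖` (memo `DressedRitzGEVP.md` §3/§7), the norms `‖O_iΩ‖²`, diagonal values `⟨O_iΩ, K_β O_iΩ⟩`, one-step
residuals and pairwise couplings.  A (β) prover computes EUCLIDEAN quantities: path integrals over slabs `L³ × T`.  This file proves, over the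
tree's objects and with no new facts, that every such vacuum number IS a limit of free-boundary slab expectations, with a geometric rate:

* §0 raw-currency helpers: products of physical test functions are physical (`isPhys_mul`); `⟨ψ,K_βψ⟩ ≤ λ₀‖ψ‖²` with no positivity proviso.
* §1 `IsVacuum β Ω θ` — the tree's ground-state package (`PhysL2.exists_groundState`: `‖Ω‖ = 1`, `K_βΩ = λ₀Ω`, Jentzsch gap
  `⟨ψ,K_βψ⟩ ≤ θ‖ψ‖²` on `Ω^⊥`, `0 ≤ θ < λ₀`) read in the linear-algebra currency of `KTPhysSpace` (`physSubmodule`, `l2Form`, `transferOp`);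
  `exists_isVacuum` (with `Ω ≥ c > 0` pointwise).
* §2 FORM GAP ⇒ OPERATOR GAP ⇒ POWER ITERATION WITH RATE: `‖K_βψ‖² ≤ θ²‖ψ‖²` on `Ω^⊥` (Cauchy–Schwarz for the positive form `qform`, tree
  `sq_qform_le`); `K_β^m ψ = (⟨Ω,ψ⟩λ₀^m)Ω + K_β^m ξ` with `‖K_β^m ξ‖² ≤ θ^{2m}‖ψ‖²` (`normSq_iterate_sub_le`).
* §3 THE DICTIONARY (`tendsto_ratio`): for `l2`-bounded linear maps `A, B` of the physical subspace (identity, `K_β^t`, multiplication by a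
  physical `f`, compositions — `IsL2Bounded.*`) and any physical `ψ` with `⟨Ω,ψ⟩ ≠ 0` (e.g. `ψ = 1`, `l2Form_vac_one_pos`):
  `⟨A K^mψ, B K^mψ⟩ / ‖K^mψ‖² → ⟨AΩ, BΩ⟩` as `m → ∞`.
* §4 RAW COROLLARIES for the prover, `Φ_m = slabGround β m = K_β^m 1`: one-point functions `⟨Φ_m, fΦ_m⟩/‖Φ_m‖² → ⟨Ω,fΩ⟩`
  (`tendsto_onePoint`), equal-time two-point functions (`tendsto_twoPoint`), and the FEYNMAN–KAC form of a time-`t` correlator with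
  free temporal boundary, normalised by the slab partition function `Z = ⟨Φ_m, K^tΦ_m⟩`:
  `⟨fΦ_m, K^t(gΦ_m)⟩ / ⟨Φ_m, K^tΦ_m⟩ → ⟨fΩ, K^t(gΩ)⟩ / λ₀^t` (`tendsto_feynmanKac`).
  With these, clause (x3) of `ExcitedPlateau` is the one-point function of `O_i` in the vacuum, and (x2)/(x4)/(x5)/(x6) are limits of ratios of
  slab path integrals with two insertions.
* §5 VACUUM SUBTRACTION MAKES (x3) EXACT: `vev Ω f = ⟨Ω, fΩ⟩`, `isPhys_sub`, `l2_vac_sub_vev : l2 Ω ((f − ⟨f⟩_Ω)Ω) = 0` — the natural witnesses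
  `w_i = (O_i − ⟨O_i⟩_Ω)Ω/‖…‖` satisfy (x3) with any `C ≥ 0`.

HONEST FRAMING: fixed-lattice functional analysis (femto rung R2b1); no renormalisation-group content; the RG estimates of the slab expectations
are the prover's burden (`stub_dressedRitz` is XL for that reason); nothing here bears on infinite volume, the continuum or the Clay gap.
References: M. Reed, B. Simon IV (1978) Thm XIII.43–44 [cite: ReedSimonIV1978]; E. Seiler, LNP 159 (1982) §3 [cite: SeilerLNP1982];
M. Lüscher, NPB 219 (1983) [cite: Luscher1983].
-/

set_option autoImplicit false

noncomputable section

open MeasureTheory Filter Topology Real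
open Literature.MathematicalPhysics.QuantumFieldTheory
open Literature.MathematicalPhysics.QuantumLattice
open Literature.Analysis.OperatorTheory.YMMatrixModel
open scoped BigOperators

namespace Summit.QuantumFields.YangMills.Cruxes.RunningReduction.VacDict

open Summit.QuantumFields.YangMills.Theorems.FemtoTransferGap
open Summit.QuantumFields.YangMills.Theorems.FemtoTransferGap.PhysL2

variable {L : ℕ} [NeZero L]

/-! ## §0 Raw-currency helpers -/

omit [NeZero L] in
/-- Products of physical zero-flux test functions are physical. [folklore] -/
theorem isPhys_mul {ψ φ : GaugeConfig 3 L SU2 → ℝ} (hψ : IsPhys ψ) (hφ : IsPhys φ) : IsPhys (ψ * φ) where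
  measurable := hψ.measurable.mul hφ.measurable
  bounded := by
    obtain ⟨C, hC⟩ := hψ.bounded
    obtain ⟨D, hD⟩ := hφ.bounded
    exact ⟨C * D, fun U => by
      rw [Pi.mul_apply, abs_mul]
      exact mul_le_mul (hC U) (hD U) (abs_nonneg _) ((abs_nonneg _).trans (hC U))⟩
  gaugeInv := fun g U => by simp only [Pi.mul_apply, hψ.gaugeInv g U, hφ.gaugeInv g U]
  zeroFlux := fun k z hz U => by simp only [Pi.mul_apply, hψ.zeroFlux k z hz U, hφ.zeroFlux k z hz U]

omit [NeZero L] in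
/-- Differences of physical zero-flux test functions are physical (used for vacuum-subtracted insertions `f − ⟨f⟩_Ω`). [folklore] -/
theorem isPhys_sub {ψ φ : GaugeConfig 3 L SU2 → ℝ} (hψ : IsPhys ψ) (hφ : IsPhys φ) : IsPhys (ψ - φ) where
  measurable := hψ.measurable.sub hφ.measurable
  bounded := by
    obtain ⟨C, hC⟩ := hψ.bounded
    obtain ⟨D, hD⟩ := hφ.bounded
    exact ⟨C + D, fun U => by
      rw [Pi.sub_apply]
      have h := abs_sub_le (ψ U) 0 (φ U)
      rw [sub_zero, zero_sub, abs_neg] at h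
      exact h.trans (add_le_add (hC U) (hD U))⟩
  gaugeInv := fun g U => by simp only [Pi.sub_apply, hψ.gaugeInv g U, hφ.gaugeInv g U]
  zeroFlux := fun k z hz U => by simp only [Pi.sub_apply, hψ.zeroFlux k z hz U, hφ.zeroFlux k z hz U]

/-- `‖fψ‖² ≤ C²‖ψ‖²` for `|f| ≤ C`. [folklore] -/
theorem l2_mul_self_le {f ψ : GaugeConfig 3 L SU2 → ℝ} (hf : IsPhys f) (hψ : IsPhys ψ) {C : ℝ} (hC : ∀ U, |f U| ≤ C) :
    l2 (f * ψ) (f * ψ) ≤ C ^ 2 * l2 ψ ψ := by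
  have hfψ := isPhys_mul hf hψ
  unfold l2
  rw [← integral_const_mul]
  refine integral_mono (hfψ.integrable_mul hfψ) ((hψ.integrable_mul hψ).const_mul _) fun U => ?_
  have h1 : (f * ψ) U * (f * ψ) U = f U ^ 2 * (ψ U * ψ U) := by simp only [Pi.mul_apply]; ring
  rw [h1]
  have hf2 : f U ^ 2 ≤ C ^ 2 := by
    have := hC U
    have h0 : 0 ≤ C := (abs_nonneg _).trans this
    calc f U ^ 2 = |f U| ^ 2 := (sq_abs _).symm
      _ ≤ C ^ 2 := pow_le_pow_left₀ (abs_nonneg _) this 2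
  exact mul_le_mul_of_nonneg_right hf2 (mul_self_nonneg _)

/-- `⟨ψ, K_βψ⟩ ≤ λ₀ ‖ψ‖²` for EVERY physical `ψ` (no positivity proviso: if `‖ψ‖² = 0` then `⟨ψ,K_βψ⟩ = ⟨ψ, Kψ⟩_{L²} = 0` by Cauchy–Schwarz).
[cite: ReedSimonIV1978, Thm. XIII.1] -/
theorem qform_self_le_levelValue_zero_mul (β : ℝ) {ψ : GaugeConfig 3 L SU2 → ℝ} (hψ : IsPhys ψ) :
    qform su2Rep β ψ ψ ≤ levelValue su2Rep L β 0 * l2 ψ ψ := by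
  rcases (l2_self_nonneg ψ).eq_or_lt with h0 | hpos
  · have hK := isPhys_transferApply (L := L) β hψ
    have hcs := sq_l2_le hψ hK
    rw [← h0, zero_mul] at hcs
    have hz : l2 ψ (transferApply β ψ) = 0 := pow_eq_zero_iff two_ne_zero |>.mp (le_antisymm hcs (sq_nonneg _))
    rw [qform_eq_l2_transferApply, hz, ← h0, mul_zero]
  · exact qform_le_levelValue_zero_mul su2Rep continuous_su2Rep β hψ hpos

/-- `|⟨x,y⟩| ≤ √‖x‖² · √‖y‖²` (Cauchy–Schwarz, square-root form). [folklore] -/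
theorem abs_l2_le_sqrt_mul_sqrt {f g : GaugeConfig 3 L SU2 → ℝ} (hf : IsPhys f) (hg : IsPhys g) :
    |l2 f g| ≤ Real.sqrt (l2 f f) * Real.sqrt (l2 g g) := by
  rw [← Real.sqrt_mul (l2_self_nonneg f)]
  exact Real.abs_le_sqrt (sq_l2_le hf hg)

/-! ## §1 The vacuum package in the linear-algebra currency of `KTPhysSpace` -/

/-- **The vacuum package** at fixed lattice `(L, β)`: `Ω` is a physical unit vector, an exact top eigenvector of the transfer operator
(`K_βΩ = λ₀Ω`, `λ₀ = levelValue su2Rep L β 0`), and `θ ∈ [0, λ₀)` is a Jentzsch bound: `⟨ψ, K_βψ⟩ ≤ θ‖ψ‖²` for every physical `ψ ⊥ Ω`.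
[cite: ReedSimonIV1978, Thm XIII.43 and Thm XIII.44] -/
structure IsVacuum (β : ℝ) (Ω : physSubmodule L) (θ : ℝ) : Prop where
  norm_one : l2Form L Ω Ω = 1
  eigen : transferOp β Ω = levelValue su2Rep L β 0 • Ω
  theta_nonneg : 0 ≤ θ
  theta_lt : θ < levelValue su2Rep L β 0
  gap : ∀ ψ : physSubmodule L, l2Form L Ω ψ = 0 → l2Form L ψ (transferOp β ψ) ≤ θ * l2Form L ψ ψ

/-- **Existence of the vacuum package**, with `Ω` uniformly positive (`0 < c ≤ Ω`) — the tree's `PhysL2.exists_groundState` read in the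
`physSubmodule` currency; every `L ≥ 1`, every real `β`. [cite: ReedSimonIV1978, Thm XIII.43 and Thm XIII.44] -/
theorem exists_isVacuum (β : ℝ) :
    ∃ (Ω : physSubmodule L) (θ c : ℝ), IsVacuum β Ω θ ∧ 0 < c ∧ ∀ U, c ≤ (Ω : GaugeConfig 3 L SU2 → ℝ) U := by
  obtain ⟨Ω, θ, c, hΩ, hc, hcle, hn, heig, hθ0, hθ, hgap⟩ := exists_groundState (L := L) β
  refine ⟨⟨Ω, hΩ⟩, θ, c, ⟨?_, ?_, hθ0, ?_, ?_⟩, hc, fun U => hcle U⟩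
  · simpa using hn
  · apply Subtype.ext
    simp only [coe_transferOp, Submodule.coe_smul]
    rw [levelValue_zero]
    exact heig
  · rw [levelValue_zero]; exact hθ
  · intro ψ hψ
    rw [l2Form_transferOp_right, l2Form_apply]
    rw [l2Form_apply, l2_comm] at hψ
    exact hgap ψ ψ.2 hψ

section Vacuum

variable {β θ : ℝ} {Ω : physSubmodule L}

/-- `λ₀ > 0`. [folklore] -/
theorem lam0_pos (β : ℝ) : 0 < levelValue su2Rep L β 0 := levelValue_zero_su2Rep_pos L β

/-- The vacuum in RAW currency — exactly the witness `φ` of clause (x3) of `KTGen.ExcitedPlateau`: `↑Ω` is physical, `‖Ω‖² = 1`,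
`K_β Ω = λ₀ Ω` as functions. [folklore] -/
theorem IsVacuum.raw (hV : IsVacuum β Ω θ) :
    IsPhys (Ω : GaugeConfig 3 L SU2 → ℝ) ∧ l2 (Ω : GaugeConfig 3 L SU2 → ℝ) (Ω : GaugeConfig 3 L SU2 → ℝ) = 1 ∧
      transferApply β (Ω : GaugeConfig 3 L SU2 → ℝ) = levelValue su2Rep L β 0 • (Ω : GaugeConfig 3 L SU2 → ℝ) := by
  refine ⟨isPhys_coe Ω, ?_, ?_⟩
  · rw [← l2Form_apply]; exact hV.norm_one
  · have h := congrArg (fun x : physSubmodule L => (x : GaugeConfig 3 L SU2 → ℝ)) hV.eigen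
    simpa only [coe_transferOp, Submodule.coe_smul] using h

/-- `⟨Ω, K_βψ⟩ = λ₀⟨Ω, ψ⟩` (symmetry of `K_β` + the eigen-equation). [folklore] -/
theorem l2Form_vac_transferOp (hV : IsVacuum β Ω θ) (ψ : physSubmodule L) :
    l2Form L Ω (transferOp β ψ) = levelValue su2Rep L β 0 * l2Form L Ω ψ := by
  rw [← transferOp_symm, hV.eigen, map_smul, LinearMap.smul_apply, smul_eq_mul]

/-- `K_β` preserves `Ω^⊥`. [folklore] -/
theorem transferOp_orth (hV : IsVacuum β Ω θ) {ψ : physSubmodule L} (h : l2Form L Ω ψ = 0) :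
    l2Form L Ω (transferOp β ψ) = 0 := by
  rw [l2Form_vac_transferOp hV, h, mul_zero]

/-! ## §2 Form gap ⇒ operator gap ⇒ power iteration with Jentzsch's rate -/

/-- **FORM GAP ⇒ OPERATOR GAP**: `‖K_βψ‖² ≤ θ²‖ψ‖²` for physical `ψ ⊥ Ω` (`β ≥ 0`).  Proof: `N := ‖Kψ‖² = ⟨ψ, K(Kψ)⟩ = qform(ψ, Kψ)`, and the
Cauchy–Schwarz inequality of the POSITIVE form `qform` (tree `sq_qform_le`) gives `N² ≤ qform(ψ,ψ)·qform(Kψ,Kψ) ≤ θ‖ψ‖² · θN`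
(`Kψ ⊥ Ω`). [cite: ReedSimonIV1978, Thm. XIII.1] -/
theorem normSq_transferOp_le_of_orth (hV : IsVacuum β Ω θ) (hβ : 0 ≤ β) {ψ : physSubmodule L} (h : l2Form L Ω ψ = 0) :
    l2Form L (transferOp β ψ) (transferOp β ψ) ≤ θ ^ 2 * l2Form L ψ ψ := by
  set N := l2Form L (transferOp β ψ) (transferOp β ψ) with hN
  have hNq : N = qform su2Rep β (ψ : GaugeConfig 3 L SU2 → ℝ) ((transferOp β ψ : physSubmodule L) : GaugeConfig 3 L SU2 → ℝ) := by
    rw [hN, transferOp_symm, l2Form_transferOp_right]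
  have h1 : qform su2Rep β (ψ : GaugeConfig 3 L SU2 → ℝ) ψ ≤ θ * l2Form L ψ ψ := by
    have := hV.gap ψ h
    rwa [l2Form_transferOp_right] at this
  have h2 : qform su2Rep β ((transferOp β ψ : physSubmodule L) : GaugeConfig 3 L SU2 → ℝ)
      ((transferOp β ψ : physSubmodule L) : GaugeConfig 3 L SU2 → ℝ) ≤ θ * N := by
    have := hV.gap (transferOp β ψ) (transferOp_orth hV h)
    rwa [l2Form_transferOp_right] at this
  have hcs := sq_qform_le hβ (isPhys_coe ψ) (isPhys_coe (transferOp β ψ))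
  rw [← hNq] at hcs
  have hN0 : 0 ≤ N := l2Form_self_nonneg _
  have hψ0 : 0 ≤ l2Form L ψ ψ := l2Form_self_nonneg _
  have hmain : N ^ 2 ≤ (θ * l2Form L ψ ψ) * (θ * N) :=
    hcs.trans (mul_le_mul h1 h2 (qform_su2Rep_self_nonneg hβ (isPhys_coe _)) (mul_nonneg hV.theta_nonneg hψ0))
  rcases hN0.eq_or_lt with hz | hpos
  · rw [← hz]; exact mul_nonneg (sq_nonneg _) hψ0
  · have : N * N ≤ (θ ^ 2 * l2Form L ψ ψ) * N := by nlinarith [hmain]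
    exact le_of_mul_le_mul_right this hpos

/-- `‖K_βψ‖² ≤ λ₀²‖ψ‖²` for EVERY physical `ψ` (same argument with the top Rayleigh bound in place of the gap). [cite: ReedSimonIV1978, Thm. XIII.1] -/
theorem normSq_transferOp_le (hβ : 0 ≤ β) (ψ : physSubmodule L) :
    l2Form L (transferOp β ψ) (transferOp β ψ) ≤ levelValue su2Rep L β 0 ^ 2 * l2Form L ψ ψ := by
  set N := l2Form L (transferOp β ψ) (transferOp β ψ) with hN
  set lam := levelValue su2Rep L β 0 with hlam
  have hlam0 : 0 ≤ lam := (lam0_pos (L := L) β).le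
  have hNq : N = qform su2Rep β (ψ : GaugeConfig 3 L SU2 → ℝ) ((transferOp β ψ : physSubmodule L) : GaugeConfig 3 L SU2 → ℝ) := by
    rw [hN, transferOp_symm, l2Form_transferOp_right]
  have h1 : qform su2Rep β (ψ : GaugeConfig 3 L SU2 → ℝ) ψ ≤ lam * l2Form L ψ ψ := by
    rw [l2Form_apply]; exact qform_self_le_levelValue_zero_mul β (isPhys_coe ψ)
  have h2 : qform su2Rep β ((transferOp β ψ : physSubmodule L) : GaugeConfig 3 L SU2 → ℝ)
      ((transferOp β ψ : physSubmodule L) : GaugeConfig 3 L SU2 → ℝ) ≤ lam * N := by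
    rw [hN, l2Form_apply]; exact qform_self_le_levelValue_zero_mul β (isPhys_coe _)
  have hcs := sq_qform_le hβ (isPhys_coe ψ) (isPhys_coe (transferOp β ψ))
  rw [← hNq] at hcs
  have hN0 : 0 ≤ N := l2Form_self_nonneg _
  have hψ0 : 0 ≤ l2Form L ψ ψ := l2Form_self_nonneg _
  have hmain : N ^ 2 ≤ (lam * l2Form L ψ ψ) * (lam * N) :=
    hcs.trans (mul_le_mul h1 h2 (qform_su2Rep_self_nonneg hβ (isPhys_coe _)) (mul_nonneg hlam0 hψ0))
  rcases hN0.eq_or_lt with hz | hpos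
  · rw [← hz]; exact mul_nonneg (sq_nonneg _) hψ0
  · have : N * N ≤ (lam ^ 2 * l2Form L ψ ψ) * N := by nlinarith [hmain]
    exact le_of_mul_le_mul_right this hpos

/-- Iterates of `K_β` on the physical subspace agree with the raw iterates `(transferApply β)^[m]`. [folklore] -/
theorem coe_iterate_transferOp (β : ℝ) (m : ℕ) (ψ : physSubmodule L) :
    (((⇑(transferOp (L := L) β))^[m] ψ : physSubmodule L) : GaugeConfig 3 L SU2 → ℝ) =
      (transferApply (L := L) β)^[m] (ψ : GaugeConfig 3 L SU2 → ℝ) := by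
  induction m with
  | zero => rfl
  | succ m ih => rw [Function.iterate_succ_apply', Function.iterate_succ_apply', coe_transferOp, ih]

/-- Iterates are additive. [folklore] -/
theorem iterate_add (β : ℝ) (m : ℕ) (x y : physSubmodule L) :
    (⇑(transferOp (L := L) β))^[m] (x + y) = (⇑(transferOp β))^[m] x + (⇑(transferOp β))^[m] y := by
  induction m with
  | zero => rfl
  | succ m ih => rw [Function.iterate_succ_apply', Function.iterate_succ_apply', Function.iterate_succ_apply', ih, map_add]

/-- Iterates are homogeneous. [folklore] -/
theorem iterate_smul (β : ℝ) (m : ℕ) (c : ℝ) (x : physSubmodule L) :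
    (⇑(transferOp (L := L) β))^[m] (c • x) = c • (⇑(transferOp β))^[m] x := by
  induction m with
  | zero => rfl
  | succ m ih => rw [Function.iterate_succ_apply', Function.iterate_succ_apply', ih, map_smul]

/-- Iterates respect subtraction. [folklore] -/
theorem iterate_sub (β : ℝ) (m : ℕ) (x y : physSubmodule L) :
    (⇑(transferOp (L := L) β))^[m] (x - y) = (⇑(transferOp β))^[m] x - (⇑(transferOp β))^[m] y := by
  induction m with
  | zero => rfl
  | succ m ih => rw [Function.iterate_succ_apply', Function.iterate_succ_apply', Function.iterate_succ_apply', ih, map_sub]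

/-- `K_β^m Ω = λ₀^m Ω`. [folklore] -/
theorem iterate_vac (hV : IsVacuum β Ω θ) (m : ℕ) :
    (⇑(transferOp (L := L) β))^[m] Ω = levelValue su2Rep L β 0 ^ m • Ω := by
  induction m with
  | zero => simp
  | succ m ih => rw [Function.iterate_succ_apply', ih, map_smul, hV.eigen, smul_smul, ← pow_succ]

/-- `K_β^m` preserves `Ω^⊥`. [folklore] -/
theorem iterate_orth (hV : IsVacuum β Ω θ) {ψ : physSubmodule L} (h : l2Form L Ω ψ = 0) (m : ℕ) :
    l2Form L Ω ((⇑(transferOp (L := L) β))^[m] ψ) = 0 := by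
  induction m with
  | zero => simpa using h
  | succ m ih => rw [Function.iterate_succ_apply']; exact transferOp_orth hV ih

/-- **Geometric decay on `Ω^⊥`**: `‖K_β^m ψ‖² ≤ θ^{2m}‖ψ‖²` for physical `ψ ⊥ Ω`. [cite: ReedSimonIV1978, Thm XIII.43 and Thm XIII.44] -/
theorem normSq_iterate_le_of_orth (hV : IsVacuum β Ω θ) (hβ : 0 ≤ β) {ψ : physSubmodule L} (h : l2Form L Ω ψ = 0) (m : ℕ) :
    l2Form L ((⇑(transferOp (L := L) β))^[m] ψ) ((⇑(transferOp β))^[m] ψ) ≤ θ ^ (2 * m) * l2Form L ψ ψ := by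
  induction m with
  | zero => simp
  | succ m ih =>
    rw [Function.iterate_succ_apply']
    calc l2Form L (transferOp β ((⇑(transferOp β))^[m] ψ)) (transferOp β ((⇑(transferOp β))^[m] ψ))
        ≤ θ ^ 2 * l2Form L ((⇑(transferOp β))^[m] ψ) ((⇑(transferOp β))^[m] ψ) :=
          normSq_transferOp_le_of_orth hV hβ (iterate_orth hV h m)
      _ ≤ θ ^ 2 * (θ ^ (2 * m) * l2Form L ψ ψ) := mul_le_mul_of_nonneg_left ih (sq_nonneg _)
      _ = θ ^ (2 * (m + 1)) * l2Form L ψ ψ := by ring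

/-- The component of `ψ` orthogonal to the vacuum: `ξ = ψ − ⟨Ω,ψ⟩Ω ⊥ Ω`. [folklore] -/
theorem orth_of_sub_proj (hV : IsVacuum β Ω θ) (ψ : physSubmodule L) :
    l2Form L Ω (ψ - l2Form L Ω ψ • Ω) = 0 := by
  rw [map_sub, map_smul, smul_eq_mul, hV.norm_one, mul_one, sub_self]

/-- `‖ψ − ⟨Ω,ψ⟩Ω‖² = ‖ψ‖² − ⟨Ω,ψ⟩² ≤ ‖ψ‖²`. [folklore] -/
theorem normSq_sub_proj (hV : IsVacuum β Ω θ) (ψ : physSubmodule L) :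
    l2Form L (ψ - l2Form L Ω ψ • Ω) (ψ - l2Form L Ω ψ • Ω) = l2Form L ψ ψ - l2Form L Ω ψ ^ 2 := by
  have hs : l2Form L ψ Ω = l2Form L Ω ψ := l2Form_symm _ _
  simp only [map_sub, map_smul, LinearMap.sub_apply, LinearMap.smul_apply, smul_eq_mul, hV.norm_one, hs]
  ring

/-- **POWER ITERATION WITH RATE** (the vacuum proxy converges to the vacuum): for every physical `ψ` and every `m`,
`K_β^m ψ = (⟨Ω,ψ⟩ λ₀^m) Ω + R_m` with `‖R_m‖² ≤ θ^{2m} ‖ψ‖²` (`R_m = K_β^m(ψ − ⟨Ω,ψ⟩Ω)`, geometric decay on `Ω^⊥`).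
[cite: ReedSimonIV1978, Thm XIII.43 and Thm XIII.44] -/
theorem iterate_decomp (hV : IsVacuum β Ω θ) (ψ : physSubmodule L) (m : ℕ) :
    (⇑(transferOp (L := L) β))^[m] ψ =
      (l2Form L Ω ψ * levelValue su2Rep L β 0 ^ m) • Ω + (⇑(transferOp β))^[m] (ψ - l2Form L Ω ψ • Ω) := by
  have hsplit : ψ = l2Form L Ω ψ • Ω + (ψ - l2Form L Ω ψ • Ω) := by abel
  conv_lhs => rw [hsplit]
  rw [iterate_add, iterate_smul, iterate_vac hV, smul_smul]

/-- The remainder estimate of `iterate_decomp`. [cite: ReedSimonIV1978, Thm XIII.43 and Thm XIII.44] -/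
theorem normSq_iterate_sub_le (hV : IsVacuum β Ω θ) (hβ : 0 ≤ β) (ψ : physSubmodule L) (m : ℕ) :
    l2Form L ((⇑(transferOp (L := L) β))^[m] ψ - (l2Form L Ω ψ * levelValue su2Rep L β 0 ^ m) • Ω)
        ((⇑(transferOp β))^[m] ψ - (l2Form L Ω ψ * levelValue su2Rep L β 0 ^ m) • Ω) ≤
      θ ^ (2 * m) * l2Form L ψ ψ := by
  have heq : (⇑(transferOp (L := L) β))^[m] ψ - (l2Form L Ω ψ * levelValue su2Rep L β 0 ^ m) • Ω =
      (⇑(transferOp β))^[m] (ψ - l2Form L Ω ψ • Ω) := by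
    rw [iterate_decomp hV ψ m, add_sub_cancel_left]
  rw [heq]
  refine (normSq_iterate_le_of_orth hV hβ (orth_of_sub_proj hV ψ) m).trans ?_
  rw [normSq_sub_proj hV]
  have hθ : 0 ≤ θ ^ (2 * m) := pow_nonneg hV.theta_nonneg _
  nlinarith [sq_nonneg (l2Form L Ω ψ)]


/-! ## §3 The dictionary: vacuum numbers as limits of normalised slab expectations -/

/-- `l2`-boundedness of a linear map of the physical subspace: `‖A x‖² ≤ M ‖x‖²` (`M ≥ 0`). [folklore] -/
def IsL2Bounded (A : physSubmodule L →ₗ[ℝ] physSubmodule L) (M : ℝ) : Prop :=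
  0 ≤ M ∧ ∀ x : physSubmodule L, l2Form L (A x) (A x) ≤ M * l2Form L x x

/-- The identity is `l2`-bounded by `1`. [folklore] -/
theorem IsL2Bounded.id : IsL2Bounded (LinearMap.id : physSubmodule L →ₗ[ℝ] physSubmodule L) 1 :=
  ⟨zero_le_one, fun x => by simp⟩

/-- `K_β` is `l2`-bounded by `λ₀²` (`β ≥ 0`). [cite: ReedSimonIV1978, Thm. XIII.1] -/
theorem IsL2Bounded.transferOp (hβ : 0 ≤ β) : IsL2Bounded (transferOp (L := L) β) (levelValue su2Rep L β 0 ^ 2) :=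
  ⟨sq_nonneg _, normSq_transferOp_le hβ⟩

/-- Compositions of `l2`-bounded maps are `l2`-bounded (bounds multiply). [folklore] -/
theorem IsL2Bounded.comp {A B : physSubmodule L →ₗ[ℝ] physSubmodule L} {MA MB : ℝ} (hA : IsL2Bounded A MA)
    (hB : IsL2Bounded B MB) : IsL2Bounded (A.comp B) (MA * MB) :=
  ⟨mul_nonneg hA.1 hB.1, fun x => by
    rw [LinearMap.comp_apply, mul_assoc]
    exact (hA.2 (B x)).trans (mul_le_mul_of_nonneg_left (hB.2 x) hA.1)⟩

/-- `K_β^t` as a linear map of the physical subspace. [folklore] -/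
def iterOp (β : ℝ) : ℕ → (physSubmodule L →ₗ[ℝ] physSubmodule L)
  | 0 => LinearMap.id
  | t + 1 => (transferOp β).comp (iterOp β t)

/-- `iterOp β t x = K_β^t x`. [folklore] -/
@[simp] theorem iterOp_apply (β : ℝ) (t : ℕ) (x : physSubmodule L) :
    iterOp (L := L) β t x = (⇑(transferOp (L := L) β))^[t] x := by
  induction t with
  | zero => rfl
  | succ t ih =>
    rw [Function.iterate_succ_apply']
    show transferOp β (iterOp β t x) = _
    rw [ih]

/-- `K_β^t` is `l2`-bounded by `λ₀^{2t}`. [cite: ReedSimonIV1978, Thm. XIII.1] -/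
theorem IsL2Bounded.iterOp (hβ : 0 ≤ β) (t : ℕ) :
    IsL2Bounded (iterOp (L := L) β t) ((levelValue su2Rep L β 0 ^ 2) ^ t) := by
  induction t with
  | zero =>
    rw [pow_zero]
    exact IsL2Bounded.id (L := L)
  | succ t ih =>
    rw [pow_succ']
    exact (IsL2Bounded.transferOp hβ).comp ih

/-- `iterOp` on raw functions: `↑(K_β^t y) = (transferApply β)^[t] ↑y`. [folklore] -/
theorem coe_iterOp (β : ℝ) (t : ℕ) (y : physSubmodule L) :
    ((iterOp (L := L) β t y : physSubmodule L) : GaugeConfig 3 L SU2 → ℝ) =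
      (transferApply β)^[t] (y : GaugeConfig 3 L SU2 → ℝ) := by
  rw [iterOp_apply, coe_iterate_transferOp]

/-- **Multiplication by a physical test function** `f` as a linear map of the physical subspace (`x ↦ f·x`; an «operator insertion at
one time slice»). [folklore] -/
def mulOp (f : GaugeConfig 3 L SU2 → ℝ) (hf : IsPhys f) : physSubmodule L →ₗ[ℝ] physSubmodule L where
  toFun x := ⟨f * (x : GaugeConfig 3 L SU2 → ℝ), isPhys_mul hf x.2⟩
  map_add' x y := by
    apply Subtype.ext
    simp only [Submodule.coe_add]
    exact mul_add _ _ _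
  map_smul' c x := by
    apply Subtype.ext
    simp only [Submodule.coe_smul, RingHom.id_apply]
    funext U
    simp only [Pi.mul_apply, Pi.smul_apply, smul_eq_mul]
    ring

omit [NeZero L] in
/-- `mulOp` unfolded. [folklore] -/
@[simp] theorem coe_mulOp {f : GaugeConfig 3 L SU2 → ℝ} (hf : IsPhys f) (x : physSubmodule L) :
    ((mulOp f hf x : physSubmodule L) : GaugeConfig 3 L SU2 → ℝ) = f * (x : GaugeConfig 3 L SU2 → ℝ) := rfl

/-- Multiplication by `f` with `|f| ≤ C` is `l2`-bounded by `C²`. [folklore] -/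
theorem IsL2Bounded.mulOp {f : GaugeConfig 3 L SU2 → ℝ} (hf : IsPhys f) {C : ℝ} (hC : ∀ U, |f U| ≤ C) :
    IsL2Bounded (mulOp (L := L) f hf) (C ^ 2) :=
  ⟨sq_nonneg _, fun x => by rw [l2Form_apply, l2Form_apply, coe_mulOp]; exact l2_mul_self_le hf x.2 hC⟩

/-- Square-root form of an `l2` bound: `√‖Ax‖² ≤ √M · √‖x‖²`. [folklore] -/
theorem IsL2Bounded.sqrt_le {A : physSubmodule L →ₗ[ℝ] physSubmodule L} {M : ℝ} (hA : IsL2Bounded A M) (x : physSubmodule L) :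
    Real.sqrt (l2Form L (A x) (A x)) ≤ Real.sqrt M * Real.sqrt (l2Form L x x) := by
  rw [← Real.sqrt_mul hA.1]
  exact Real.sqrt_le_sqrt (hA.2 x)

/-- Cauchy–Schwarz in the `physSubmodule` currency. [folklore] -/
theorem abs_l2Form_le (x y : physSubmodule L) :
    |l2Form L x y| ≤ Real.sqrt (l2Form L x x) * Real.sqrt (l2Form L y y) :=
  abs_l2_le_sqrt_mul_sqrt (isPhys_coe x) (isPhys_coe y)

/-- Continuity estimate for the bilinear functional `e ↦ ⟨A(Ω+e), B(Ω+e)⟩` at `e = 0` (`‖Ω‖ = 1`):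
`|⟨A(Ω+e),B(Ω+e)⟩ − ⟨AΩ,BΩ⟩| ≤ √MA √MB (2√‖e‖² + ‖e‖²)`. [folklore] -/
theorem abs_bilin_sub_le (hV : IsVacuum β Ω θ) {A B : physSubmodule L →ₗ[ℝ] physSubmodule L} {MA MB : ℝ}
    (hA : IsL2Bounded A MA) (hB : IsL2Bounded B MB) (e : physSubmodule L) :
    |l2Form L (A (Ω + e)) (B (Ω + e)) - l2Form L (A Ω) (B Ω)| ≤
      Real.sqrt MA * Real.sqrt MB * (2 * Real.sqrt (l2Form L e e) + l2Form L e e) := by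
  set s := l2Form L e e with hs
  have hs0 : 0 ≤ s := l2Form_self_nonneg _
  have hΩ1 : Real.sqrt (l2Form L Ω Ω) = 1 := by rw [hV.norm_one, Real.sqrt_one]
  have hexp : l2Form L (A (Ω + e)) (B (Ω + e)) - l2Form L (A Ω) (B Ω) =
      l2Form L (A Ω) (B e) + l2Form L (A e) (B Ω) + l2Form L (A e) (B e) := by
    simp only [map_add, LinearMap.add_apply]; ring
  rw [hexp]
  have hMA : 0 ≤ Real.sqrt MA := Real.sqrt_nonneg _
  have hMB : 0 ≤ Real.sqrt MB := Real.sqrt_nonneg _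
  have t1 : |l2Form L (A Ω) (B e)| ≤ Real.sqrt MA * Real.sqrt MB * Real.sqrt s := by
    refine (abs_l2Form_le _ _).trans ?_
    calc Real.sqrt (l2Form L (A Ω) (A Ω)) * Real.sqrt (l2Form L (B e) (B e))
        ≤ (Real.sqrt MA * Real.sqrt (l2Form L Ω Ω)) * (Real.sqrt MB * Real.sqrt s) :=
          mul_le_mul (hA.sqrt_le Ω) (hB.sqrt_le e) (Real.sqrt_nonneg _) (by positivity)
      _ = Real.sqrt MA * Real.sqrt MB * Real.sqrt s := by rw [hΩ1]; ring
  have t2 : |l2Form L (A e) (B Ω)| ≤ Real.sqrt MA * Real.sqrt MB * Real.sqrt s := by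
    refine (abs_l2Form_le _ _).trans ?_
    calc Real.sqrt (l2Form L (A e) (A e)) * Real.sqrt (l2Form L (B Ω) (B Ω))
        ≤ (Real.sqrt MA * Real.sqrt s) * (Real.sqrt MB * Real.sqrt (l2Form L Ω Ω)) :=
          mul_le_mul (hA.sqrt_le e) (hB.sqrt_le Ω) (Real.sqrt_nonneg _) (by positivity)
      _ = Real.sqrt MA * Real.sqrt MB * Real.sqrt s := by rw [hΩ1]; ring
  have t3 : |l2Form L (A e) (B e)| ≤ Real.sqrt MA * Real.sqrt MB * s := by
    refine (abs_l2Form_le _ _).trans ?_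
    calc Real.sqrt (l2Form L (A e) (A e)) * Real.sqrt (l2Form L (B e) (B e))
        ≤ (Real.sqrt MA * Real.sqrt s) * (Real.sqrt MB * Real.sqrt s) :=
          mul_le_mul (hA.sqrt_le e) (hB.sqrt_le e) (Real.sqrt_nonneg _) (by positivity)
      _ = Real.sqrt MA * Real.sqrt MB * (Real.sqrt s * Real.sqrt s) := by ring
      _ = Real.sqrt MA * Real.sqrt MB * s := by rw [Real.mul_self_sqrt hs0]
  calc |l2Form L (A Ω) (B e) + l2Form L (A e) (B Ω) + l2Form L (A e) (B e)|
      ≤ |l2Form L (A Ω) (B e)| + |l2Form L (A e) (B Ω)| + |l2Form L (A e) (B e)| := abs_add_three _ _ _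
    _ ≤ Real.sqrt MA * Real.sqrt MB * Real.sqrt s + Real.sqrt MA * Real.sqrt MB * Real.sqrt s +
          Real.sqrt MA * Real.sqrt MB * s := add_le_add (add_le_add t1 t2) t3
    _ = Real.sqrt MA * Real.sqrt MB * (2 * Real.sqrt s + s) := by ring

/-- ★ **THE VACUUM DICTIONARY (power iteration ∕ transfer-matrix form of Feynman–Kac with free temporal boundary).**  For the vacuum package
`(Ω, θ)` at `β ≥ 0`, `l2`-bounded linear maps `A, B` of the physical subspace, and any physical `ψ` with `⟨Ω, ψ⟩ ≠ 0`:
`⟨A K_β^m ψ, B K_β^m ψ⟩ / ‖K_β^m ψ‖² → ⟨AΩ, BΩ⟩` as `m → ∞` (rate `(θ/λ₀)^m`).  With `ψ = 1` the vectors `K_β^m 1 = Φ_m` are the free-boundary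
slabs, and the left side is a ratio of two slab path integrals. [cite: ReedSimonIV1978, Thm XIII.43 and Thm XIII.44] -/
theorem tendsto_ratio (hV : IsVacuum β Ω θ) (hβ : 0 ≤ β) {A B : physSubmodule L →ₗ[ℝ] physSubmodule L} {MA MB : ℝ}
    (hA : IsL2Bounded A MA) (hB : IsL2Bounded B MB) (ψ : physSubmodule L) (ha : l2Form L Ω ψ ≠ 0) :
    Tendsto (fun m : ℕ => l2Form L (A ((⇑(transferOp (L := L) β))^[m] ψ)) (B ((⇑(transferOp β))^[m] ψ)) /
        l2Form L ((⇑(transferOp β))^[m] ψ) ((⇑(transferOp β))^[m] ψ)) atTop (𝓝 (l2Form L (A Ω) (B Ω))) := by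
  set lam := levelValue su2Rep L β 0 with hlam_def
  have hlam : 0 < lam := lam0_pos (L := L) β
  set a := l2Form L Ω ψ with ha_def
  set c : ℕ → ℝ := fun m => a * lam ^ m with hc
  have hc0 : ∀ m, c m ≠ 0 := fun m => mul_ne_zero ha (pow_ne_zero _ hlam.ne')
  -- the normalised error vectors `e m`, with `K^m ψ = c m • (Ω + e m)`
  set e : ℕ → physSubmodule L := fun m => (c m)⁻¹ • ((⇑(transferOp β))^[m] ψ - c m • Ω) with he
  have hE : ∀ m, (⇑(transferOp (L := L) β))^[m] ψ = c m • (Ω + e m) := by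
    intro m
    simp only [he, smul_add, smul_sub, smul_smul, mul_inv_cancel₀ (hc0 m), inv_mul_cancel₀ (hc0 m), one_smul]
    abel
  -- `‖e m‖² → 0` geometrically
  set s : ℕ → ℝ := fun m => l2Form L (e m) (e m) with hs
  have hs0 : ∀ m, 0 ≤ s m := fun m => l2Form_self_nonneg _
  have hs_le : ∀ m, s m ≤ ((θ / lam) ^ 2) ^ m * (l2Form L ψ ψ / a ^ 2) := by
    intro m
    have h1 := normSq_iterate_sub_le hV hβ ψ m
    have hsm : s m = ((c m)⁻¹) ^ 2 *
        l2Form L ((⇑(transferOp β))^[m] ψ - c m • Ω) ((⇑(transferOp β))^[m] ψ - c m • Ω) := by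
      simp only [hs, he, map_smul, LinearMap.smul_apply, smul_eq_mul]
      ring
    rw [hsm]
    calc ((c m)⁻¹) ^ 2 * l2Form L ((⇑(transferOp β))^[m] ψ - c m • Ω) ((⇑(transferOp β))^[m] ψ - c m • Ω)
        ≤ ((c m)⁻¹) ^ 2 * (θ ^ (2 * m) * l2Form L ψ ψ) := mul_le_mul_of_nonneg_left h1 (sq_nonneg _)
      _ = ((θ / lam) ^ 2) ^ m * (l2Form L ψ ψ / a ^ 2) := by
          simp only [hc]
          rw [inv_pow, inv_mul_eq_div, ← pow_mul, div_pow, div_mul_div_comm]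
          congr 1
          ring
  have hr1 : (θ / lam) ^ 2 < 1 := by
    have h01 : 0 ≤ θ / lam := div_nonneg hV.theta_nonneg hlam.le
    have hlt : θ / lam < 1 := (div_lt_one hlam).mpr hV.theta_lt
    nlinarith
  have hs_tend : Tendsto s atTop (𝓝 0) := by
    have hg := (tendsto_pow_atTop_nhds_zero_of_lt_one (sq_nonneg (θ / lam)) hr1).mul_const (l2Form L ψ ψ / a ^ 2)
    rw [zero_mul] at hg
    exact squeeze_zero hs0 hs_le hg
  have hsq_tend : Tendsto (fun m => Real.sqrt (s m)) atTop (𝓝 0) := by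
    simpa using hs_tend.sqrt
  have hg_tend : ∀ K : ℝ, Tendsto (fun m => K * (2 * Real.sqrt (s m) + s m)) atTop (𝓝 0) := by
    intro K
    have := ((hsq_tend.const_mul 2).add hs_tend).const_mul K
    simpa using this
  -- numerator and denominator after removing the common factor `c m ^ 2`
  set u : ℕ → ℝ := fun m => l2Form L (A (Ω + e m)) (B (Ω + e m)) with hu
  set v : ℕ → ℝ := fun m => l2Form L (Ω + e m) (Ω + e m) with hv
  have hu_tend : Tendsto u atTop (𝓝 (l2Form L (A Ω) (B Ω))) := by
    rw [tendsto_iff_norm_sub_tendsto_zero]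
    refine squeeze_zero (fun m => norm_nonneg _) (fun m => ?_) (hg_tend (Real.sqrt MA * Real.sqrt MB))
    rw [Real.norm_eq_abs]
    exact abs_bilin_sub_le hV hA hB (e m)
  have hv_tend : Tendsto v atTop (𝓝 1) := by
    rw [tendsto_iff_norm_sub_tendsto_zero]
    refine squeeze_zero (fun m => norm_nonneg _) (fun m => ?_) (hg_tend (Real.sqrt 1 * Real.sqrt 1))
    rw [Real.norm_eq_abs]
    have h := abs_bilin_sub_le hV (IsL2Bounded.id (L := L)) (IsL2Bounded.id (L := L)) (e m)
    simp only [LinearMap.id_coe, id_eq, hV.norm_one] at h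
    exact h
  -- the ratio equals `u m / v m`
  have hratio : ∀ m, l2Form L (A ((⇑(transferOp (L := L) β))^[m] ψ)) (B ((⇑(transferOp β))^[m] ψ)) /
      l2Form L ((⇑(transferOp β))^[m] ψ) ((⇑(transferOp β))^[m] ψ) = u m / v m := by
    intro m
    rw [hE m]
    simp only [map_smul, LinearMap.smul_apply, smul_eq_mul, hu, hv]
    rw [mul_div_mul_left _ _ (hc0 m), mul_div_mul_left _ _ (hc0 m)]
  rw [show (fun m : ℕ => l2Form L (A ((⇑(transferOp (L := L) β))^[m] ψ)) (B ((⇑(transferOp β))^[m] ψ)) /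
      l2Form L ((⇑(transferOp β))^[m] ψ) ((⇑(transferOp β))^[m] ψ)) = fun m => u m / v m from funext hratio]
  have := hu_tend.div hv_tend one_ne_zero
  rw [div_one] at this
  exact this

/-! ## §4 Raw corollaries for the prover: slabs `Φ_m = slabGround β m = K_β^m 1` -/

/-- The constant test function `1` as an element of the physical subspace. [folklore] -/
def one : physSubmodule L := ⟨fun _ => 1, isPhys_const 1⟩

omit [NeZero L] in
/-- `1` unfolded. [folklore] -/
@[simp] theorem coe_one : ((one : physSubmodule L) : GaugeConfig 3 L SU2 → ℝ) = fun _ => 1 := rfl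

/-- `K_β^m 1 = Φ_m` (the free-boundary slab of `m` layers). [folklore] -/
theorem coe_iterate_one (β : ℝ) (m : ℕ) :
    (((⇑(transferOp (L := L) β))^[m] one : physSubmodule L) : GaugeConfig 3 L SU2 → ℝ) = slabGround (L := L) β m := by
  rw [coe_iterate_transferOp]
  rfl

/-- `⟨Ω, 1⟩ = ∫Ω > 0` for a uniformly positive vacuum (`exists_isVacuum`): the slabs `Φ_m` are admissible start vectors. [folklore] -/
theorem l2Form_vac_one_pos {Ω : physSubmodule L} {c : ℝ} (hc : 0 < c) (hcle : ∀ U, c ≤ (Ω : GaugeConfig 3 L SU2 → ℝ) U) :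
    0 < l2Form L Ω one := by
  rw [l2Form_apply]
  exact l2_pos_of_le (isPhys_coe Ω) (isPhys_const 1) hc one_pos hcle (fun _ => le_rfl)

/-- **ONE-POINT FUNCTIONS**: `⟨Φ_m, f Φ_m⟩ / ‖Φ_m‖² → ⟨Ω, fΩ⟩` — the vacuum expectation of the insertion `f` is the limit of its free-boundary
slab expectation at the middle slice (`⟨K^m1, f K^m 1⟩ / ⟨K^m 1, K^m 1⟩`, slab of `2m` layers).  This is clause (x3) of `ExcitedPlateau` for
`w = fΩ/‖fΩ‖`. [cite: SeilerLNP1982, §3] -/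
theorem tendsto_onePoint (hV : IsVacuum β Ω θ) (hβ : 0 ≤ β) (hΩ1 : l2Form L Ω one ≠ 0) {f : GaugeConfig 3 L SU2 → ℝ}
    (hf : IsPhys f) :
    Tendsto (fun m : ℕ => l2 (slabGround (L := L) β m) (f * slabGround β m) / l2 (slabGround (L := L) β m) (slabGround β m))
      atTop (𝓝 (l2 (Ω : GaugeConfig 3 L SU2 → ℝ) (f * (Ω : GaugeConfig 3 L SU2 → ℝ)))) := by
  obtain ⟨C, hC⟩ := hf.bounded
  have h := tendsto_ratio hV hβ (IsL2Bounded.id (L := L)) (IsL2Bounded.mulOp hf hC) one hΩ1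
  simp only [LinearMap.id_coe, id_eq, l2Form_apply, coe_mulOp, coe_iterate_one] at h
  exact h

/-- **FEYNMAN–KAC, free temporal boundary**: the time-`t` two-point function of insertions `f`, `g` in a slab of `2m + t` layers, normalised
by the slab partition function, converges to the vacuum correlator:
`⟨fΦ_m, K_β^t(gΦ_m)⟩ / ⟨Φ_m, K_β^tΦ_m⟩ → ⟨fΩ, K_β^t(gΩ)⟩ / λ₀^t` as `m → ∞` (`t = 0`: equal-time two-point functions, norms `‖fΩ‖²`;
`t = 1, 2`: the diagonal values and one-step residuals of (x4)/(x5)/(x6) of `ExcitedPlateau` for `w = fΩ/‖fΩ‖`).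
[cite: SeilerLNP1982, §3] [cite: Luscher1983] -/
theorem tendsto_feynmanKac (hV : IsVacuum β Ω θ) (hβ : 0 ≤ β) (hΩ1 : l2Form L Ω one ≠ 0)
    {f g : GaugeConfig 3 L SU2 → ℝ} (hf : IsPhys f) (hg : IsPhys g) (t : ℕ) :
    Tendsto (fun m : ℕ =>
        l2 (f * slabGround (L := L) β m) ((transferApply β)^[t] (g * slabGround β m)) /
          l2 (slabGround (L := L) β m) ((transferApply β)^[t] (slabGround β m)))
      atTop (𝓝 (l2 (f * (Ω : GaugeConfig 3 L SU2 → ℝ)) ((transferApply β)^[t] (g * (Ω : GaugeConfig 3 L SU2 → ℝ))) /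
        levelValue su2Rep L β 0 ^ t)) := by
  obtain ⟨C, hC⟩ := hf.bounded
  obtain ⟨D, hD⟩ := hg.bounded
  have hlam : 0 < levelValue su2Rep L β 0 := lam0_pos (L := L) β
  -- numerator ratio
  have hN := tendsto_ratio hV hβ (IsL2Bounded.mulOp hf hC) ((IsL2Bounded.iterOp hβ t).comp (IsL2Bounded.mulOp hg hD)) one hΩ1
  -- denominator ratio
  have hD' := tendsto_ratio hV hβ (IsL2Bounded.id (L := L)) (IsL2Bounded.iterOp hβ t) one hΩ1
  simp only [LinearMap.id_coe, id_eq] at hD'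
  have hlim : l2Form L Ω (iterOp (L := L) β t Ω) = levelValue su2Rep L β 0 ^ t := by
    rw [iterOp_apply, iterate_vac hV, map_smul, smul_eq_mul, hV.norm_one, mul_one]
  rw [hlim] at hD'
  have hq := hN.div hD' (pow_ne_zero _ hlam.ne')
  simp only [LinearMap.comp_apply, l2Form_apply, coe_mulOp, coe_iterOp, coe_iterate_one] at hq
  refine hq.congr fun m => ?_
  have hz : l2 (slabGround (L := L) β m) (slabGround β m) ≠ 0 := (l2_slabGround_pos β m).ne'
  simp only [Pi.div_apply]
  rw [div_div_div_cancel_right₀ hz]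

/-- **EQUAL-TIME TWO-POINT FUNCTIONS** (`t = 0` of `tendsto_feynmanKac`): `⟨fΦ_m, gΦ_m⟩ / ‖Φ_m‖² → ⟨fΩ, gΩ⟩`; with `g = f` the norms
`‖fΩ‖²` normalising the witnesses `w = fΩ/‖fΩ‖` of `ExcitedPlateau`, with `f ≠ g` their overlaps (x2). [cite: SeilerLNP1982, §3] -/
theorem tendsto_twoPoint (hV : IsVacuum β Ω θ) (hβ : 0 ≤ β) (hΩ1 : l2Form L Ω one ≠ 0)
    {f g : GaugeConfig 3 L SU2 → ℝ} (hf : IsPhys f) (hg : IsPhys g) :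
    Tendsto (fun m : ℕ => l2 (f * slabGround (L := L) β m) (g * slabGround β m) / l2 (slabGround (L := L) β m) (slabGround β m))
      atTop (𝓝 (l2 (f * (Ω : GaugeConfig 3 L SU2 → ℝ)) (g * (Ω : GaugeConfig 3 L SU2 → ℝ)))) := by
  simpa using tendsto_feynmanKac hV hβ hΩ1 hf hg 0

/-! ## §5 Vacuum subtraction makes clause (x3) EXACT -/

/-- The vacuum expectation value `⟨f⟩_Ω = ⟨Ω, fΩ⟩` of an insertion `f` (the limit in `tendsto_onePoint`). [folklore] -/
def vev (Ω : physSubmodule L) (f : GaugeConfig 3 L SU2 → ℝ) : ℝ :=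
  l2 (Ω : GaugeConfig 3 L SU2 → ℝ) (f * (Ω : GaugeConfig 3 L SU2 → ℝ))

/-- `tendsto_onePoint` restated: `⟨Φ_m, fΦ_m⟩/‖Φ_m‖² → ⟨f⟩_Ω`. [cite: SeilerLNP1982, §3] -/
theorem tendsto_onePoint_vev (hV : IsVacuum β Ω θ) (hβ : 0 ≤ β) (hΩ1 : l2Form L Ω one ≠ 0) {f : GaugeConfig 3 L SU2 → ℝ}
    (hf : IsPhys f) :
    Tendsto (fun m : ℕ => l2 (slabGround (L := L) β m) (f * slabGround β m) / l2 (slabGround (L := L) β m) (slabGround β m))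
      atTop (𝓝 (vev Ω f)) :=
  tendsto_onePoint hV hβ hΩ1 hf

omit [NeZero L] in
/-- The vacuum-subtracted insertion as a linear map: `(f − c)·x = f·x − c•x`. [folklore] -/
theorem mulOp_sub_const {f : GaugeConfig 3 L SU2 → ℝ} (hf : IsPhys f) (c : ℝ) (x : physSubmodule L) :
    mulOp (f - fun _ => c) (isPhys_sub hf (isPhys_const c)) x = mulOp f hf x - c • x := by
  apply Subtype.ext
  simp only [coe_mulOp, Submodule.coe_sub, Submodule.coe_smul]
  funext U
  simp only [Pi.mul_apply, Pi.sub_apply, Pi.smul_apply, smul_eq_mul]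
  ring

/-- ★ **(x3) is exact after vacuum subtraction**: `⟨Ω, (f − ⟨f⟩_Ω)Ω⟩ = 0`.  Hence the natural witnesses `w = (f − ⟨f⟩_Ω)Ω/‖(f − ⟨f⟩_Ω)Ω‖` of
`KTGen.ExcitedPlateau` satisfy clause (x3) with ANY constant `C ≥ 0`; no estimate is needed there. [folklore] -/
theorem l2Form_vac_mulOp_sub_vev (hV : IsVacuum β Ω θ) {f : GaugeConfig 3 L SU2 → ℝ} (hf : IsPhys f) :
    l2Form L Ω (mulOp (f - fun _ => vev Ω f) (isPhys_sub hf (isPhys_const _)) Ω) = 0 := by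
  rw [mulOp_sub_const hf, map_sub, map_smul, smul_eq_mul, hV.norm_one, mul_one, l2Form_apply, coe_mulOp]
  exact sub_self _

/-- Raw form of `l2Form_vac_mulOp_sub_vev`: `l2 Ω ((f − ⟨f⟩_Ω)·Ω) = 0`. [folklore] -/
theorem l2_vac_sub_vev (hV : IsVacuum β Ω θ) {f : GaugeConfig 3 L SU2 → ℝ} (hf : IsPhys f) :
    l2 (Ω : GaugeConfig 3 L SU2 → ℝ) ((f - fun _ => vev Ω f) * (Ω : GaugeConfig 3 L SU2 → ℝ)) = 0 := by
  have h := l2Form_vac_mulOp_sub_vev hV hf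
  rwa [l2Form_apply, coe_mulOp] at h

end Vacuum

end Summit.QuantumFields.YangMills.Cruxes.RunningReduction.VacDict

end
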